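import Literature.AlgebraicGeometry.Resolution.TameAbelianMonomialStep
import HarnessLib

/-!
# Invariants of a commuting family of tame automorphisms: monomial generators (abelian tame groups)

Topic: `Literature/AlgebraicGeometry/Resolution`. PROOF side of `CossartPiltant2019ReductionP`
(`ArithmeticalThreefoldsLocal.lean`), input (C4), toric route. Iterating the cyclic step of
`TameAbelianMonomialStep.lean` along a COMMUTING family `τ₀, …, τ_{r-1}` of tame, residually
trivial automorphisms acting diagonally on `x₁, …, x_d` (`τᵢ xⱼ = ζ^{sᵢⱼ} xⱼ`): the ring of joint
invariants `A = {c ∈ C : τᵢ c = c ∀ i}` of a Noetherian local `C ⊆ F` dominated by `O` with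
`𝔪_C` generated by monomials `x^{g}` is again Noetherian, local, dominated by `O`, with `𝔪_A`
generated by finitely many monomials `x^{G}`, `G` an `ℕ`-combination of the `g`'s with
`ℓ ∣ sᵢ·G` for all `i` — the input of `exists_toricChart_isRegularLocalRing_of_addSubgroup`
(`ToricChartRegularity.lean`) for the abelian tame groups of exponent `ℓ` met at the
Kummer-covering site of `hC4` ([CoP1] Prop. 6.2 (2): "the action is diagonal"; proof of
Lemma 9.4).

* `exists_monomial_generators_fixedSubring_of_commuting` — PROVED.

Everything is PROVED; no named facts are introduced.

## Sources

* V. Cossart, O. Piltant, *Resolution of singularities of threefolds in positive characteristic.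
  I*, J. Algebra 320 (2008) 1051–1082: Prop. 6.2 (2) (28)–(30) and proof of Lemma 9.4
  (HAL hal-00139124, pp. 19, 28–29). [CossartPiltant2008]
-/

noncomputable section

namespace Literature.AlgebraicGeometry.Resolution

universe u

open IsLocalRing

section Family

variable {F : Type u} [Field F] (O : ValuationSubring F)

/-- **Joint invariants of a commuting family of tame automorphisms** ([CoP1] Prop. 6.2 (2),
proof of Lemma 9.4; abelian tame groups of exponent `ℓ`). Let `τ₀, …, τ_{r-1}` be pairwise
commuting automorphisms of the field `F` with `τᵢ^ℓ = 1`, `C ⊆ F` a Noetherian local subring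
dominated by the valuation ring `O`, stable under every `τᵢ`, with `ℓ ∈ C^×`, a common fixed
`ℓ`-th root of unity `ζ ∈ C` (`ζ^k - 1 ∈ C^×`, `0 < k < ℓ`), every `τᵢ` residually trivial on
`C`, `x₁, …, x_d ∈ F` joint eigenvectors (`τᵢ xⱼ = ζ^{sᵢⱼ} xⱼ`) and `𝔪_C` generated by monomials
`x^{g_1}, …, x^{g_m} ∈ C`. Then the ring of joint invariants `A` is a Noetherian local subring
dominated by `O` and `𝔪_A` is generated by finitely many monomials `x^{G_k} ∈ A` with
`G_k ∈ ∑ ℕ g_i` and `ℓ ∣ ∑ⱼ sᵢⱼ G_{kj}` for every `i < r`.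
[cite: CossartPiltant2008, Prop. 6.2 (2) (28)–(30) and proof of Lemma 9.4 (HAL pp. 19, 29)] -/
theorem exists_monomial_generators_fixedSubring_of_commuting (τ : ℕ → F ≃+* F) (r : ℕ) {ℓ : ℕ}
    (hℓ0 : ℓ ≠ 0) (hτℓ : ∀ i < r, τ i ^ ℓ = 1)
    (hcomm : ∀ i < r, ∀ i' < r, ∀ z : F, τ i (τ i' z) = τ i' (τ i z))
    (C : Subring F) [IsLocalRing C] [IsNoetherianRing C]
    (hdomC : ∀ c : C, c ∈ maximalIdeal C ↔ O.valuation (c : F) < 1)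
    (hτC : ∀ i < r, ∀ c ∈ C, τ i c ∈ C) (hℓu : IsUnit ((ℓ : C)))
    (ζ : F) (hζC : ζ ∈ C) (hτζ : ∀ i < r, τ i ζ = ζ) (hζℓ : ζ ^ ℓ = 1)
    (hζu : ∀ k : ℕ, 0 < k → k < ℓ → IsUnit ((⟨ζ, hζC⟩ : C) ^ k - 1))
    (hres : ∀ i < r, ∀ c ∈ C, O.valuation (τ i c - c) < 1)
    {d : ℕ} (x : Fin d → F) (s : ℕ → Fin d → ℕ)
    (hτx : ∀ i < r, ∀ j, τ i (x j) = ζ ^ s i j * x j)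
    {m : ℕ} (g : Fin m → (Fin d → ℕ)) (hgC : ∀ i, (∏ j, x j ^ g i j) ∈ C)
    (hspan : Ideal.span (Set.range fun i => (⟨∏ j, x j ^ g i j, hgC i⟩ : C)) = maximalIdeal C)
    (A : Subring F) (hA : ∀ b, b ∈ A ↔ b ∈ C ∧ ∀ i < r, τ i b = b) :
    ∃ (_ : IsLocalRing A) (_ : IsNoetherianRing A),
      (∀ a : A, a ∈ maximalIdeal A ↔ O.valuation (a : F) < 1) ∧
      ∃ (m' : ℕ) (g' : Fin m' → (Fin d → ℕ)) (hg'A : ∀ k, (∏ j, x j ^ g' k j) ∈ A),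
        (∀ k, ∃ w : Fin m → ℕ, g' k = ∑ i, w i • g i) ∧
        (∀ i < r, ∀ k, ℓ ∣ ∑ j, s i j * g' k j) ∧
        Ideal.span (Set.range fun k => (⟨∏ j, x j ^ g' k j, hg'A k⟩ : A)) = maximalIdeal A := by
  classical
  -- fixed subrings and the tower `C_k = C ∩ Fix τ₀ ∩ ⋯ ∩ Fix τ_{k-1}`
  let Fix : ℕ → Subring F := fun i =>
    { carrier := {z | τ i z = z}
      mul_mem' := fun {a b} ha hb => by change τ i (a * b) = a * b; rw [map_mul, ha, hb]
      one_mem' := map_one (τ i)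
      add_mem' := fun {a b} ha hb => by change τ i (a + b) = a + b; rw [map_add, ha, hb]
      zero_mem' := map_zero (τ i)
      neg_mem' := fun {a} ha => by change τ i (-a) = -a; rw [map_neg, ha] }
  have hFix : ∀ i z, z ∈ Fix i ↔ τ i z = z := fun i z => Iff.rfl
  let Cf : ℕ → Subring F := fun k => Nat.rec (motive := fun _ => Subring F) C (fun i acc => acc ⊓ Fix i) k
  have hCf0 : Cf 0 = C := rfl
  have hCfsucc : ∀ k, Cf (k + 1) = Cf k ⊓ Fix k := fun k => rfl
  have hmemCf : ∀ k b, b ∈ Cf k ↔ b ∈ C ∧ ∀ i < k, τ i b = b := by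
    intro k
    induction k with
    | zero => intro b; simp [hCf0]
    | succ k ih =>
      intro b
      rw [hCfsucc, Subring.mem_inf, ih, hFix]
      constructor
      · rintro ⟨⟨hbC, hb⟩, hbk⟩
        exact ⟨hbC, fun i hi => by
          rcases Nat.lt_succ_iff_lt_or_eq.mp hi with hi | rfl
          · exact hb i hi
          · exact hbk⟩
      · rintro ⟨hbC, hb⟩
        exact ⟨⟨hbC, fun i hi => hb i (Nat.lt_succ_of_lt hi)⟩, hb k (Nat.lt_succ_self k)⟩
  have hCfle : ∀ k, Cf k ≤ C := fun k b hb => ((hmemCf k b).mp hb).1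
  -- the induction
  have key : ∀ k, k ≤ r →
      ∃ (_ : IsLocalRing (Cf k)) (_ : IsNoetherianRing (Cf k)),
        (∀ a : Cf k, a ∈ maximalIdeal (Cf k) ↔ O.valuation (a : F) < 1) ∧
        ∃ (m' : ℕ) (g' : Fin m' → (Fin d → ℕ)) (hg'A : ∀ a, (∏ j, x j ^ g' a j) ∈ Cf k),
          (∀ a, ∃ w : Fin m → ℕ, g' a = ∑ i, w i • g i) ∧
          (∀ i < k, ∀ a, ℓ ∣ ∑ j, s i j * g' a j) ∧
          Ideal.span (Set.range fun a => (⟨∏ j, x j ^ g' a j, hg'A a⟩ : Cf k)) =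
            maximalIdeal (Cf k) := by
    intro k
    induction k with
    | zero =>
      intro _
      refine ⟨(inferInstance : IsLocalRing C), (inferInstance : IsNoetherianRing C), hdomC, m, g,
        hgC, fun a => ⟨Pi.single a 1, ?_⟩, fun i hi => absurd hi (Nat.not_lt_zero i), hspan⟩
      rw [Finset.sum_eq_single a (fun b _ hb => by rw [Pi.single_eq_of_ne hb, zero_smul])
        (fun h => absurd (Finset.mem_univ a) h), Pi.single_eq_same, one_smul]
    | succ k ih =>
      intro hk
      have hk' : k < r := Nat.lt_of_succ_le hk
      obtain ⟨hloc, hnoe, hdomk, m₁, g₁, hg₁, hcomb₁, hdiv₁, hspan₁⟩ := ih hk'.le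
      haveI := hloc
      haveI := hnoe
      -- `τ k` preserves `C_k`
      have hτCk : ∀ c ∈ Cf k, τ k c ∈ Cf k := by
        intro c hc
        rw [hmemCf] at hc ⊢
        refine ⟨hτC k hk' c hc.1, fun i hi => ?_⟩
        rw [hcomm i (hi.trans hk') k hk', hc.2 i hi]
      -- units of `C` lying in `C_k` are units of `C_k`
      have hunitk : ∀ (a : Cf k), IsUnit (⟨(a : F), hCfle k a.2⟩ : C) → IsUnit a := by
        intro a h
        obtain ⟨v, hv⟩ := h.exists_right_inv
        have hv' : (a : F) * (v : F) = 1 := by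
          have := congrArg Subtype.val hv
          simpa using this
        have ha := (hmemCf k (a : F)).mp a.2
        have hτv : ∀ i < k, τ i (v : F) = v := by
          intro i hi
          have h1 : (a : F) * τ i (v : F) = 1 := by
            have := congrArg (τ i) hv'
            rwa [map_mul, ha.2 i hi, map_one] at this
          calc τ i (v : F) = τ i (v : F) * ((a : F) * (v : F)) := by rw [hv', mul_one]
            _ = ((a : F) * τ i (v : F)) * (v : F) := by ring
            _ = v := by rw [h1, one_mul]
        exact IsUnit.of_mul_eq_one (⟨(v : F), (hmemCf k _).mpr ⟨v.2, hτv⟩⟩ : Cf k) (Subtype.ext hv')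
      have hℓuk : IsUnit ((ℓ : Cf k)) := hunitk _ (by
        have : (⟨((ℓ : Cf k) : F), hCfle k (ℓ : Cf k).2⟩ : C) = (ℓ : C) := Subtype.ext (by simp)
        rw [this]; exact hℓu)
      have hζCk : ζ ∈ Cf k := (hmemCf k ζ).mpr ⟨hζC, fun i hi => hτζ i (hi.trans hk')⟩
      have hζuk : ∀ j : ℕ, 0 < j → j < ℓ → IsUnit ((⟨ζ, hζCk⟩ : Cf k) ^ j - 1) := by
        intro j hj hjℓ
        refine hunitk _ ?_
        have : (⟨(((⟨ζ, hζCk⟩ : Cf k) ^ j - 1 : Cf k) : F), hCfle k ((⟨ζ, hζCk⟩ : Cf k) ^ j - 1).2⟩ : C) =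
            (⟨ζ, hζC⟩ : C) ^ j - 1 := Subtype.ext (by simp)
        rw [this]; exact hζu j hj hjℓ
      have hresk : ∀ c ∈ Cf k, O.valuation (τ k c - c) < 1 := fun c hc => hres k hk' c (hCfle k hc)
      have hC' : ∀ b, b ∈ Cf (k + 1) ↔ b ∈ Cf k ∧ τ k b = b := fun b => by
        rw [hCfsucc, Subring.mem_inf, hFix]
      obtain ⟨hloc', hnoe', hdom', m₂, g₂, hg₂, hcomb₂, hdiv₂, hspan₂⟩ :=
        exists_monomial_generators_fixedSubring O (τ k) hℓ0 (hτℓ k hk') (Cf k) hdomk hτCk hℓuk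
          ζ hζCk (hτζ k hk') hζℓ hζuk hresk x (s k) (hτx k hk') g₁ hg₁ hspan₁ (Cf (k + 1)) hC'
      refine ⟨hloc', hnoe', hdom', m₂, g₂, hg₂, fun a => ?_, fun i hi a => ?_, hspan₂⟩
      · -- combinations compose
        obtain ⟨w₂, hw₂⟩ := hcomb₂ a
        choose w₁ hw₁ using hcomb₁
        refine ⟨fun i => ∑ b, w₂ b * w₁ b i, ?_⟩
        rw [hw₂]
        simp only [hw₁, Finset.smul_sum, Finset.sum_smul, smul_smul]
        rw [Finset.sum_comm]
      · -- divisibility: new index `k` from the step, old indices through the combination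
        rcases Nat.lt_succ_iff_lt_or_eq.mp hi with hi | rfl
        · obtain ⟨w₂, hw₂⟩ := hcomb₂ a
          rw [hw₂]
          have hsum : (∑ j, s i j * (∑ b, w₂ b • g₁ b) j) = ∑ b, w₂ b * ∑ j, s i j * g₁ b j := by
            simp only [Finset.sum_apply, Pi.smul_apply, smul_eq_mul, Finset.mul_sum]
            rw [Finset.sum_comm]
            exact Finset.sum_congr rfl fun b _ => Finset.sum_congr rfl fun j _ => by ring
          rw [hsum]
          exact Finset.dvd_sum fun b _ => Dvd.dvd.mul_left (hdiv₁ i hi b) _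
        · exact hdiv₂ a
  -- `C_r = A`
  have hAeq : A = Cf r := Subring.ext fun b => by rw [hA, hmemCf]
  subst hAeq
  exact key r le_rfl

end Family

end Literature.AlgebraicGeometry.Resolution

end
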